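import Literature.Analysis.FluidPDE.CompressibleEulerWellPosedness
import Literature.Analysis.FluidPDE.CompressibleEulerJunction
import Literature.Analysis.FluidPDE.CompressibleEulerAprioriBounds
import HarnessLib

/-!
# The `C¹` continuation principle for the complete compressible Euler system on `𝕋³` from local
# existence

Analysis/FluidPDE proof file (theorems only; no definitions, no named facts). Majda's sharp
continuation principle (Majda 1984, Ch. 2 §2.1, Thm 2.2 with Cor. 1–2; Dafermos 2005, Ch. V,
Thm 5.1.1, maximality clause) for classical solutions of the complete Euler system of a monatomic
fluid with the athermal pressure law `p = ρϑζ(ρ)`, `e = 3ϑ/2` (`EulerEOS.monatomicExcess ζ f`,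
`ζ` smooth, `(ρζ)' > 0` on `(0, ρ̄)`), in the `C^∞` rendering of the tree: a classical solution on
`[0, T) × 𝕋³` whose state stays in a compact part of the hyperbolicity region
(`M⁻¹ ≤ ρ ≤ ρ₁ < ρ̄`, `M⁻¹ ≤ ϑ ≤ M`) and whose `C¹` size stays bounded
(`‖u‖, ‖Dρ‖, ‖Du‖, ‖Dϑ‖ ≤ M`) extends to a classical solution on some `[0, T₂) × 𝕋³`, `T₂ > T`,
PROVIDED classical solutions exist locally from smooth data with `0 < ρ₀ < ρ̄`, `ϑ₀ > 0` — i.e.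
clause (ii) of the named fact `Literature.Analysis.FluidPDE.CompressibleEulerLocalWellPosedness`
follows from its clause (i) (`CompressibleEuler.continuation_of_localExistence`), and the whole
fact from local existence alone (`compressibleEulerLocalWellPosedness_of_localExistence`).

The proof is the printed one (Majda 1984, proof of Thm 2.2; Dafermos 2005, pp. 125–126), in the
form that needs NO uniqueness theorem and NO quantitative existence time:

1. **a-priori bounds** — the `C¹` bound and the compact state box bound ALL spatial derivatives
   of the solution on `[0, T) × 𝕋³` (`IsClassicalEulerSolution.spatialWordBounds_of_C1`, file
   `CompressibleEulerAprioriBounds`: the symmetrised `H^m` energy estimates, Majda (2.38) /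
   Dafermos (5.1.25), at every level `m`, with Grönwall);
2. **extension, restart and junction** — hence the solution extends smoothly to the closed slab
   `[0, T] × 𝕋³`; the local solution issued from its value at `t = T` has the same `∞`-jet at
   `T` because both solve the same evolution equation, so the two glue to a classical solution on
   `[0, T₂)`, `T₂ > T`, with state in any prescribed open neighbourhood of the box — here
   `{ρ < ρ̄}` (`IsClassicalEulerSolution.exists_extension_of_spatialBounds`, file
   `CompressibleEulerJunction`).

The hard-sphere special case (`hsEuler_continuation` from `hsEuler_localExistence`) is
`Literature.MathematicalPhysics.KineticTheory.hsEuler_continuation_of_hsEuler_localExistence`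
(`HardSphereEulerContinuation.lean`); the present file is its general-`ζ` form, stated in the
vocabulary of `CompressibleEulerLocalWellPosedness`.

## Mathlib / tree search

Tree: `IsClassicalEulerSolution.spatialWordBounds_of_C1` (`CompressibleEulerAprioriBounds`),
`IsClassicalEulerSolution.exists_extension_of_spatialBounds` (`CompressibleEulerJunction`),
`IsClassicalEulerSolution.temperature_pos`, `Torus.partialDeriv_eq_fderiv_apply`;
`continuation_of_uniform_restart` (`CompressibleEulerContinuation`, the alternative reduction of
clause (ii) to a UNIFORM restart time plus uniqueness — not used here).

## References

* A. Majda, *Compressible Fluid Flow and Systems of Conservation Laws in Several Space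
  Variables*, Appl. Math. Sci. 53, Springer 1984, Ch. 2 §2.1, Thm 2.2, Cor. 1–2. [`Majda1984`]
* C. M. Dafermos, *Hyperbolic Conservation Laws in Continuum Physics*, 2nd ed., Springer 2005,
  Ch. V §5.1, Thm 5.1.1 and its proof, pp. 122–126. [`Dafermos2005`]
-/

noncomputable section

open Set Filter
open _root_.Topology
open scoped ContDiff

namespace Literature.Analysis.FluidPDE

open Literature.Analysis.FunctionSpaces
open Literature.MathematicalPhysics.KineticTheory (T3 V3)

namespace CompressibleEuler

variable {ζ f : ℝ → ℝ} {ρm : ℝ}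

/-- `‖∂ᵢφ(x)‖ ≤ ‖Dφ(x)‖` for a smooth field `φ` on the torus (`∂ᵢφ = Dφ eᵢ`, `‖eᵢ‖ = 1`).
[folklore] -/
private theorem norm_partialDeriv_le_norm_torusFDeriv {F : Type*} [NormedAddCommGroup F]
    [NormedSpace ℝ F] {φ : T3 → F} (hφ : Torus.IsSmooth φ) (i : Fin 3) (x : T3) :
    ‖Torus.partialDeriv i φ x‖ ≤ ‖Torus.fderiv φ x‖ := by
  rw [Torus.partialDeriv_eq_fderiv_apply (hφ.isContDiff (by simp)) i x]
  refine (ContinuousLinearMap.le_opNorm _ _).trans ?_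
  have : ‖(EuclideanSpace.single i (1 : ℝ))‖ = 1 := by
    rw [EuclideanSpace.norm_eq]; simp [Finset.sum_ite_eq']
  rw [this, mul_one]

/-- **The `C¹` continuation principle from local existence** (Majda 1984, Thm 2.2 with Cor. 1–2;
Dafermos 2005, Thm 5.1.1): for the athermal monatomic law `p = ρϑζ(ρ)`, `e = 3ϑ/2` with `ζ`
smooth and `(ρζ)' > 0` on `(0, ρ̄)`, IF classical solutions exist locally from all smooth data
`0 < ρ₀ < ρ̄`, `ϑ₀ > 0` (with density `< ρ̄`), THEN every classical solution on `[0, T) × 𝕋³`,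
`T > 0`, with `M⁻¹ ≤ ρ ≤ ρ₁ < ρ̄`, `M⁻¹ ≤ ϑ ≤ M`, `‖u‖, ‖Dρ‖, ‖Du‖, ‖Dϑ‖ ≤ M` extends to a
classical solution on some `[0, T₂) × 𝕋³`, `T₂ > T`, agreeing with it on `[0, T)` and with
density `< ρ̄` throughout. Proof: the state box `K = [M⁻¹, ρ₁] × [M⁻¹, M]` is a compact subset of
the hyperbolicity region `{ρ > 0, ϑ > 0, (ρζ)' > 0}`; all spatial derivatives are bounded on
`[0, T) × 𝕋³` (`spatialWordBounds_of_C1`); local solutions restart from every smooth datum with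
state in `K` (hypothesis); so the solution extends past `T` with state in the open set
`U = {ρ < ρ̄} ⊇ K` (`exists_extension_of_spatialBounds`).
[cite: Majda1984, Ch. 2 §2.1 Thm 2.2, Cor. 1–2] -/
theorem continuation_of_localExistence (hζ : ContDiff ℝ ∞ ζ)
    (hζ' : ∀ r ∈ Ioo 0 ρm, 0 < deriv (fun s => s * ζ s) r)
    (hLE : ∀ (ρ₀ θ₀ : T3 → ℝ) (u₀ : T3 → V3), Torus.IsSmooth ρ₀ → Torus.IsSmooth θ₀ →
      Torus.IsSmooth u₀ → (∀ x, 0 < ρ₀ x) → (∀ x, ρ₀ x < ρm) → (∀ x, 0 < θ₀ x) →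
      ∃ T : ℝ, 0 < T ∧ ∃ (ρ θ : ℝ → T3 → ℝ) (u : ℝ → T3 → V3),
        IsClassicalEulerSolution (EulerEOS.monatomicExcess ζ f) T ρ u θ ∧
          ρ 0 = ρ₀ ∧ u 0 = u₀ ∧ θ 0 = θ₀ ∧ ∀ t ∈ Ico 0 T, ∀ x, ρ t x < ρm)
    {T : ℝ} (hT : 0 < T) {ρ θ : ℝ → T3 → ℝ} {u : ℝ → T3 → V3}
    (h : IsClassicalEulerSolution (EulerEOS.monatomicExcess ζ f) T ρ u θ)
    (hb : ∃ M ρ₁ : ℝ, ρ₁ < ρm ∧ ∀ t ∈ Ico 0 T, ∀ x,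
      M⁻¹ ≤ ρ t x ∧ ρ t x ≤ ρ₁ ∧ M⁻¹ ≤ θ t x ∧ θ t x ≤ M ∧ ‖u t x‖ ≤ M ∧
        ‖Torus.fderiv (ρ t) x‖ ≤ M ∧ ‖Torus.fderiv (u t) x‖ ≤ M ∧ ‖Torus.fderiv (θ t) x‖ ≤ M) :
    ∃ T₂ : ℝ, T < T₂ ∧ ∃ (ρ' θ' : ℝ → T3 → ℝ) (u' : ℝ → T3 → V3),
      IsClassicalEulerSolution (EulerEOS.monatomicExcess ζ f) T₂ ρ' u' θ' ∧
        (∀ t ∈ Ico 0 T, ρ' t = ρ t ∧ u' t = u t ∧ θ' t = θ t) ∧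
        ∀ t ∈ Ico 0 T₂, ∀ x, ρ' t x < ρm := by
  obtain ⟨M, ρ₁, hρ₁, hb⟩ := hb
  have h0 : (0 : ℝ) ∈ Ico 0 T := ⟨le_rfl, hT⟩
  -- `M > 0` because the temperature is positive and `≤ M` at some point
  have hM : 0 < M := by
    obtain ⟨-, -, -, h2, -⟩ := hb 0 h0 0
    exact (h.temperature_pos 0 h0 0).trans_le h2
  have hMi : 0 < M⁻¹ := inv_pos.2 hM
  -- the compact state box
  set K : Set (ℝ × ℝ) := Icc M⁻¹ ρ₁ ×ˢ Icc M⁻¹ M with hKdef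
  have hK : IsCompact K := isCompact_Icc.prod isCompact_Icc
  have hstate : ∀ t ∈ Ico 0 T, ∀ x, (ρ t x, θ t x) ∈ K := by
    intro t ht x
    obtain ⟨h1, h2, h3, h4, -⟩ := hb t ht x
    exact ⟨⟨h1, h2⟩, ⟨h3, h4⟩⟩
  have hKr : ∀ z ∈ K, 0 < z.1 ∧ z.1 < ρm ∧ 0 < z.2 := by
    rintro ⟨r, s⟩ ⟨⟨hr1, hr2⟩, ⟨hs1, -⟩⟩
    exact ⟨hMi.trans_le hr1, hr2.trans_lt hρ₁, hMi.trans_le hs1⟩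
  have hKpos : K ⊆ Ioi 0 ×ˢ Ioi 0 := fun z hz => ⟨(hKr z hz).1, (hKr z hz).2.2⟩
  have hKhyp : K ⊆ {z : ℝ × ℝ | 0 < z.1 ∧ 0 < z.2 ∧ 0 < deriv (fun s => s * ζ s) z.1} :=
    fun z hz => ⟨(hKr z hz).1, (hKr z hz).2.2, hζ' z.1 ⟨(hKr z hz).1, (hKr z hz).2.1⟩⟩
  -- `C¹` bounds of the partial derivatives and the a-priori bounds of all spatial derivatives
  have hC1 : ∀ t ∈ Ico 0 T, ∀ x, ‖u t x‖ ≤ M ∧ ∀ i, |Torus.partialDeriv i (ρ t) x| ≤ M ∧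
      ‖Torus.partialDeriv i (u t) x‖ ≤ M ∧ |Torus.partialDeriv i (θ t) x| ≤ M := by
    intro t ht x
    obtain ⟨-, -, -, -, b5, b6, b7, b8⟩ := hb t ht x
    have hρs := h.smooth_density.isSmooth_slice ht
    have hus := h.smooth_velocity.isSmooth_slice ht
    have hθs := h.smooth_temperature.isSmooth_slice ht
    refine ⟨b5, fun i => ⟨?_, ?_, ?_⟩⟩
    · rw [← Real.norm_eq_abs]; exact (norm_partialDeriv_le_norm_torusFDeriv hρs i x).trans b6
    · exact (norm_partialDeriv_le_norm_torusFDeriv hus i x).trans b7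
    · rw [← Real.norm_eq_abs]; exact (norm_partialDeriv_le_norm_torusFDeriv hθs i x).trans b8
  have hbd := h.spatialWordBounds_of_C1 hζ hT hK hKhyp hstate hC1
  -- the restart hypothesis for data with state in `K`
  have hLE' : ∀ (ρ₀ ϑ₀ : T3 → ℝ) (u₀ : T3 → V3), Torus.IsSmooth ρ₀ → Torus.IsSmooth ϑ₀ →
      Torus.IsSmooth u₀ → (∀ x, (ρ₀ x, ϑ₀ x) ∈ K) →
      ∃ T' : ℝ, 0 < T' ∧ ∃ (ρ' ϑ' : ℝ → T3 → ℝ) (u' : ℝ → T3 → V3),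
        IsClassicalEulerSolution (EulerEOS.monatomicExcess ζ f) T' ρ' u' ϑ' ∧
          ρ' 0 = ρ₀ ∧ u' 0 = u₀ ∧ ϑ' 0 = ϑ₀ := by
    intro ρ₀ ϑ₀ u₀ hρ₀ hϑ₀ hu₀ hK₀
    obtain ⟨T', hT', ρ', θ', u', hsol, hρ0, hu0, hθ0, -⟩ := hLE ρ₀ ϑ₀ u₀ hρ₀ hϑ₀ hu₀
      (fun x => (hKr _ (hK₀ x)).1) (fun x => (hKr _ (hK₀ x)).2.1) (fun x => (hKr _ (hK₀ x)).2.2)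
    exact ⟨T', hT', ρ', θ', u', hsol, hρ0, hu0, hθ0⟩
  -- the open neighbourhood `{ρ < ρ̄}` of `K`
  set U : Set (ℝ × ℝ) := {z | z.1 < ρm} with hUdef
  have hUo : IsOpen U := isOpen_lt continuous_fst continuous_const
  have hKU : K ⊆ U := fun z hz => (hKr z hz).2.1
  obtain ⟨T₂, hT₂, ρ₂, ϑ₂, u₂, hsol₂, hagree, hU₂⟩ :=
    h.exists_extension_of_spatialBounds hζ hT hK hKpos hstate hbd hLE' hUo hKU
  exact ⟨T₂, hT₂, ρ₂, ϑ₂, u₂, hsol₂, hagree, fun t ht x => hU₂ t ht x⟩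

end CompressibleEuler

open CompressibleEuler in
/-- **`CompressibleEulerLocalWellPosedness` follows from its local-existence clause alone**: the
continuation clause (ii) of the named fact (Majda 1984, Thm 2.2, Cor. 1–2) is a theorem of the
tree GIVEN the local-existence clause (i) (Majda 1984, Thm 2.1), by
`CompressibleEuler.continuation_of_localExistence`. Whoever proves local existence of classical
solutions for the athermal monatomic law on `𝕋³` (Kato 1975 / Majda 1984 Thm 2.1 / Dafermos 2005
Thm 5.1.1, existence part) discharges the whole fact through this theorem.
[cite: Majda1984, Ch. 2 §2.1 Thms 2.1–2.2, Cor. 1–2] -/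
theorem compressibleEulerLocalWellPosedness_of_localExistence
    (hLE : ∀ (ζ f : ℝ → ℝ) (ρm : ℝ), ContDiff ℝ ∞ ζ → 0 < ρm →
      (∀ r ∈ Ioo 0 ρm, 0 < deriv (fun s => s * ζ s) r) →
      ∀ (ρ₀ θ₀ : T3 → ℝ) (u₀ : T3 → V3), Torus.IsSmooth ρ₀ → Torus.IsSmooth θ₀ →
        Torus.IsSmooth u₀ → (∀ x, 0 < ρ₀ x) → (∀ x, ρ₀ x < ρm) → (∀ x, 0 < θ₀ x) →
        ∃ T : ℝ, 0 < T ∧ ∃ (ρ θ : ℝ → T3 → ℝ) (u : ℝ → T3 → V3),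
          IsClassicalEulerSolution (EulerEOS.monatomicExcess ζ f) T ρ u θ ∧
            ρ 0 = ρ₀ ∧ u 0 = u₀ ∧ θ 0 = θ₀ ∧ ∀ t ∈ Ico 0 T, ∀ x, ρ t x < ρm) :
    CompressibleEulerLocalWellPosedness := by
  intro ζ f ρm hζ hρm hζ'
  refine ⟨hLE ζ f ρm hζ hρm hζ', fun T hT ρ θ u h hb => ?_⟩
  exact continuation_of_localExistence hζ hζ' (hLE ζ f ρm hζ hρm hζ') hT h hb

end Literature.Analysis.FluidPDE

end
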